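import Summits.Langlands.Langlands.Theses.PicardMuOrdinary

/-!
# The hypothesis class of `MuOrdinaryFamilyRT`: `#Gal ∈ {12, 24}` and `f ⊗ ℚ` irreducible

Negative-lane helper for the crux `PicardMuOrdinary.MuOrdinaryFamilyRT` (stmt-Langlands-13757),
standing disprover refuter-cdisprove-stmt-Langlands-13757-g2-0, cycle 2 (2026-08-16).

The crux quantifies over `f : ℤ[X]` with `f.natDegree = 4`, `(f ⊗ ℚ).Separable` and
`12 ∣ #Gal(f ⊗ ℚ)`.  Together with `SepRedundant.lean` (separability is implied) the two theorems
below pin the class exactly: `#Gal ∈ {12, 24}` (`Gal ↪ S₄`) and `f ⊗ ℚ` IRREDUCIBLE (a factor of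
degree `i ∈ {1,2,3}` would give `#Gal ∣ i!·(4−i)! ∈ {6, 4}`), i.e. the irreducible rational
quartics with Galois group `A₄` or `S₄` — the residually absolutely irreducible Picard curves, as
the route's informal text asserts.  Anatomy, not a refutation; provers of the lines' "Picard
representation" stubs may import `irreducible_of_twelve_dvd_card_gal`.
-/

namespace Summit.Langlands.Langlands.Theorems.MuOrdinaryFamilyRT.Negative

set_option linter.dupNamespace false

open Polynomial


/-- The Galois group of a rational polynomial embeds in the permutations of at most `natDegree`
roots, so its order divides `natDegree !`. [folklore] -/
theorem card_gal_dvd_factorial (g : ℚ[X]) : Nat.card g.Gal ∣ (g.natDegree).factorial := by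
  classical
  let L := g.SplittingField
  have hS : (g.map (algebraMap ℚ L)).Splits := SplittingField.splits g
  haveI : Fact ((g.map (algebraMap ℚ L)).Splits) := ⟨hS⟩
  have hdvd : Nat.card g.Gal ∣ (Nat.card (g.rootSet L)).factorial := by
    rw [← Nat.card_perm]
    exact Subgroup.card_dvd_of_injective _ (Gal.galActionHom_injective g L)
  refine dvd_trans hdvd (Nat.factorial_dvd_factorial ?_)
  have hrs : Nat.card (g.rootSet L) = (g.map (algebraMap ℚ L)).roots.toFinset.card := by
    rw [rootSet_def, Finset.coe_sort_coe, Nat.card_eq_finsetCard]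
  rw [hrs]
  calc (g.map (algebraMap ℚ L)).roots.toFinset.card ≤ (g.map (algebraMap ℚ L)).roots.card :=
        Multiset.toFinset_card_le _
    _ ≤ (g.map (algebraMap ℚ L)).natDegree := card_roots' _
    _ = g.natDegree := natDegree_map _

/-- The Galois group of a product embeds in the product of the Galois groups. [folklore] -/
theorem card_gal_mul_dvd (a b : ℚ[X]) :
    Nat.card (a * b).Gal ∣ Nat.card a.Gal * Nat.card b.Gal := by
  rw [← Nat.card_prod]
  exact Subgroup.card_dvd_of_injective _ (Gal.restrictProd_injective a b)

/-- **Anatomy of the hypothesis class, I.** For an integer quartic, `12 ∣ #Gal(f ⊗ ℚ)` forces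
`#Gal ∈ {12, 24}` (`Gal ↪ S₄`). [folklore] -/
theorem card_gal_eq_twelve_or_twentyfour (f : ℤ[X]) (hdeg : f.natDegree = 4)
    (hgal : 12 ∣ Nat.card (f.map (Int.castRingHom ℚ)).Gal) :
    Nat.card (f.map (Int.castRingHom ℚ)).Gal = 12 ∨ Nat.card (f.map (Int.castRingHom ℚ)).Gal = 24 := by
  set g := f.map (Int.castRingHom ℚ) with hg
  have hgdeg : g.natDegree = 4 := by
    rw [hg, natDegree_map_eq_of_injective (Int.castRingHom ℚ).injective_int, hdeg]
  have h24 : Nat.card g.Gal ∣ 24 := by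
    have := card_gal_dvd_factorial g
    rw [hgdeg] at this
    exact this
  obtain ⟨c, hc⟩ := hgal
  have hpos : 0 < Nat.card g.Gal := Nat.card_pos
  rw [hc] at h24 hpos ⊢
  have hle : 12 * c ≤ 24 := Nat.le_of_dvd (by norm_num) h24
  have hc2 : c ≤ 2 := by omega
  interval_cases c <;> simp_all

/-- **Anatomy of the hypothesis class, II.** For an integer quartic, `12 ∣ #Gal(f ⊗ ℚ)` forces
`f ⊗ ℚ` to be IRREDUCIBLE: a factor of degree `i ∈ {1,2,3}` would give
`#Gal ∣ i! · (4 − i)! ∈ {6, 4}`.  Together with I: the crux ranges exactly over the irreducible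
rational quartics with Galois group `A₄` or `S₄` (the residually absolutely irreducible Picard
curves), as the route's informal text asserts. [folklore] -/
theorem irreducible_of_twelve_dvd_card_gal (f : ℤ[X]) (hdeg : f.natDegree = 4)
    (hgal : 12 ∣ Nat.card (f.map (Int.castRingHom ℚ)).Gal) :
    Irreducible (f.map (Int.castRingHom ℚ)) := by
  set g := f.map (Int.castRingHom ℚ) with hg
  have hgdeg : g.natDegree = 4 := by
    rw [hg, natDegree_map_eq_of_injective (Int.castRingHom ℚ).injective_int, hdeg]
  have hg0 : g ≠ 0 := by
    intro h; rw [h, natDegree_zero] at hgdeg; exact absurd hgdeg (by norm_num)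
  have hgu : ¬ IsUnit g := by
    intro h
    have := natDegree_eq_zero_of_isUnit h
    omega
  by_contra hirr
  obtain ⟨a, b, hab, ha, hb⟩ : ∃ a b, g = a * b ∧ ¬ IsUnit a ∧ ¬ IsUnit b := by
    by_contra h
    push Not at h
    exact hirr (irreducible_iff.mpr ⟨hgu, fun a b hab' => or_iff_not_imp_left.mpr (h a b hab')⟩)
  have ha0 : a ≠ 0 := by rintro rfl; exact hg0 (by simp [hab])
  have hb0 : b ≠ 0 := by rintro rfl; exact hg0 (by simp [hab])
  have hda : 0 < a.natDegree := natDegree_pos_iff_degree_pos.mpr (degree_pos_of_ne_zero_of_nonunit ha0 ha)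
  have hdb : 0 < b.natDegree := natDegree_pos_iff_degree_pos.mpr (degree_pos_of_ne_zero_of_nonunit hb0 hb)
  have hsum : a.natDegree + b.natDegree = 4 := by
    rw [← hgdeg, hab, natDegree_mul ha0 hb0]
  have hdvd : Nat.card g.Gal ∣ a.natDegree.factorial * b.natDegree.factorial := by
    rw [hab]
    exact dvd_trans (card_gal_mul_dvd a b)
      (mul_dvd_mul (card_gal_dvd_factorial a) (card_gal_dvd_factorial b))
  have h12 : 12 ∣ a.natDegree.factorial * b.natDegree.factorial := dvd_trans hgal hdvd
  -- a.natDegree ∈ {1,2,3}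
  have hb' : b.natDegree = 4 - a.natDegree := by omega
  rw [hb'] at h12
  have ha4 : a.natDegree < 4 := by omega
  interval_cases h : a.natDegree <;> simp_all (config := {decide := true})


end Summit.Langlands.Langlands.Theorems.MuOrdinaryFamilyRT.Negative
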